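import Literature.MathematicalPhysics.KineticTheory.CollisionTubeVarianceStatics
import Literature.MathematicalPhysics.KineticTheory.HardSphereDecoratedPairSumVariance
import Literature.MathematicalPhysics.KineticTheory.CollisionFluxUpperBound
import Literature.Probability.Moments.ConditionalVarianceSplit
import HarnessLib

/-!
# The collision-tube functional at rung 0: the decorated tube sum on the product space

Topic `Literature/MathematicalPhysics/KineticTheory` (kind proof; the variance (hA)₀ of the TUBE side of
the Enskog closure at rung 0, crux line `even-rung-mean-variance` of `JParityClosure.EvenStressEnskog`,
stmt-AtomisticToContinuum-13079; prelude of `CollisionTubeVarianceRung0`).  Constant profiles, `N + 1`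
spheres of diameter `ε = ε_N` on `𝕋³`, rung-0 law `G_N = zipConfig_# (P_N ⊗ ⊗ᵢ N(u, θ))`
(`HardSphereUniformGas`; `P_N = posGibbsMeasure 1 ε (N+1)` after `posGibbsMeasure_const_eq_one`):

* `variance_localGibbsLaw_rung0_eq` — `Var_{G_N}(A) = Var_{P_N ⊗ Q}(A ∘ zipConfig)`
  (`integral_localGibbsLaw_rung0`; `zipConfig` is a measurable equivalence);
* `tubeStat_zipConfig_eq` — the collision-tube functional at level `1`, pulled back, is the normalised
  double sum of `χ(t, xᵢ) g(σ³ρ̃_r(x, xᵢ)) pairTubeMark_{ij}` (`tubeStat_one_eq_sum_tubeMark`);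
* `variance_prod_decoratedTubeSum_le` — the DECORATED TUBE SUM `S(x, v) = Σ_{i≠j} h(xᵢ) pairTubeMark_{ij}`
  (`|h| ≤ 1`) has, under `P_N ⊗ γ^{⊗(N+1)}` and GIVEN the decorated pair-pair decorrelation of `P_N` for
  indicators at level `ζ`,
  `Var(S) ≤ 64 L² C_p² (N+1) + 2 (N+1)² (16 B² v + 96 (N+1) B² v² + 4 ζ (N+1)² B² v²)`,
  `B = 2L`, `C_p = (3 + 4Lκ)³`, `v = (4π/3)(ε(1 + 2Lκ))³`: law of total variance (`variance_prod_le`),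
  the velocity variance at fixed positions (`variance_pi_decoratedTubeSum_le`, Efron–Stein and packing)
  and the position variance of the conditional mean, which is the decorated pair sum of
  `HardSphereDecoratedPairSumVariance` with the velocity-averaged tube mark (`integral_pi_decoratedTubeSum`,
  `variance_decoratedPairSum_le`);
* `variance_add_le_two_mul` — `Var(X + Y) ≤ 2 Var X + 2 Var Y`.

References: C. Cercignani, R. Illner, M. Pulvirenti (1994) §2.2 [CIPDiluteGases1994]; D. Ruelle (1969)
§4.2 [Ruelle1969]; H. Spohn (1991) Part I §2.3 [Spohn1991].
-/

noncomputable section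

namespace Literature.MathematicalPhysics.KineticTheory

open MeasureTheory ProbabilityTheory Set Filter Function
open scoped ENNReal InnerProductSpace BigOperators
open Literature.Analysis.FluidPDE Literature.Probability.Moments

/-! ## Transfer of the variance to the product space -/

/-- **Rung-0 transfer of the variance**: for constant profiles `a > 0`, `θ > 0`, `u` and an observable `A`
whose pull-back `A ∘ zipConfig` is measurable,
`Var_{G_N}(A) = Var_{P_N ⊗ ⊗ᵢN(u,θ)}(A ∘ zipConfig)` with `P_N` the activity-`1` canonical measure.
[folklore] -/
theorem variance_localGibbsLaw_rung0_eq (σ : ℝ) {a θ : ℝ} (ha : 0 < a) (hθ : 0 < θ) (u : V3) (N : ℕ)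
    (Φ : HardSphereFlow (Torus.geometry (Fin 3)) (hsDiameter σ N) (N + 1))
    {A : Config (N + 1) (Fin 3) T3 → ℝ} (hA : Measurable fun p => A (zipConfig p)) :
    variance A (localGibbsLaw σ (fun _ => a) (fun _ => u) (fun _ => θ) N Φ) =
      variance (fun p => A (zipConfig p)) ((posGibbsMeasure (fun _ : T3 => (1 : ℝ)) (hsDiameter σ N) (N + 1)).prod
        (Measure.pi fun _ : Fin (N + 1) => gaussMeasure u θ)) := by
  -- `A` itself is measurable, `zipConfig` being a measurable equivalence
  set e := (MeasurableEquiv.arrowProdEquivProdArrow T3 V3 (Fin (N + 1))) with he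
  have hAe : A = (fun p => A (zipConfig p)) ∘ e := by
    funext z; simp only [comp_apply, zipConfig, he, MeasurableEquiv.symm_apply_apply]
  have hAm : Measurable A := by rw [hAe]; exact hA.comp e.measurable
  rw [variance_eq_integral hAm.aemeasurable, integral_localGibbsLaw_rung0 σ ha.le hθ u N Φ,
    integral_localGibbsLaw_rung0 σ ha.le hθ u N Φ, posGibbsMeasure_const_eq_one ha,
    variance_eq_integral hA.aemeasurable]

/-! ## The double-sum form on the product space -/

/-- The collision-tube functional at level `1`, pulled back along `zipConfig`, as a double sum of
density-weighted pair tube marks (`σ > 0`, `L ≥ 0`). [folklore] -/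
theorem tubeStat_zipConfig_eq {σ : ℝ} (hσ : 0 < σ) (N : ℕ) (χ : ℝ × UnitAddTorus (Fin 3) → ℝ) (g : ℝ → ℝ)
    (k l : Fin 3) {L : ℝ} (hL : 0 ≤ L) (r κ t : ℝ) (x : Fin (N + 1) → T3) (v : Fin (N + 1) → V3) :
    tubeStat σ N χ g (evenMarkTrunc k l L) r r 1 κ t (zipConfig (x, v)) = ((N + 1 : ℝ) * κ)⁻¹ * ∑ i, ∑ j,
      if i ≠ j then χ (t, x i) * g (σ ^ 3 * empDensity r x (x i)) *
        pairTubeMark (hsDiameter σ N) κ (evenMarkTrunc k l L) i j x v else 0 := by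
  rw [tubeStat_one_eq_sum_tubeMark hσ N χ g (evenMarkTrunc_eq_zero_of_inner_eq_zero k l hL) r r κ t]
  rfl

/-! ## The decorated tube sum `S` on the product space and its variance -/

/-- The decorated tube sum `S(x, v) = Σ_{i≠j} h(xᵢ) M_{ij}(x, v)` is jointly measurable. [folklore] -/
theorem measurable_decoratedTubeSum {n : ℕ} (ε κ : ℝ) {Ξ : V3 × V3 × V3 → ℝ} (hΞ : Measurable Ξ)
    {h : T3 → ℝ} (hh : Measurable h) :
    Measurable fun p : (Fin n → T3) × (Fin n → V3) =>
      ∑ i, ∑ j, if i ≠ j then h (p.1 i) * pairTubeMark ε κ Ξ i j p.1 p.2 else 0 := by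
  refine Finset.measurable_sum _ fun i _ => Finset.measurable_sum _ fun j _ => ?_
  by_cases hij : i ≠ j
  · simp only [if_pos hij]
    exact ((hh.comp ((measurable_pi_apply i).comp measurable_fst))).mul (measurable_pairTubeMark ε κ hΞ i j)
  · simp only [if_neg hij]; exact measurable_const

/-- **Variance of the decorated tube sum under `P_N ⊗ γ^{⊗(N+1)}`** (small density, `N ≥ 1`, `L > 0`,
`0 ≤ κ`, `ε(1 + 2Lκ) < 1/2`, `|h| ≤ 1` measurable, probability law `γ`), GIVEN the decorated pair-pair
decorrelation bound at level `ζ`: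
`Var(S) ≤ 64 L² C_p² (N+1) + 2 (N+1)² (16 B² v + 96 (N+1) B² v² + 4 ζ (N+1)² B² v²)` with `B = 2L`,
`C_p = (3 + 4Lκ)³`, `v ≤ (4π/3)(ε(1 + 2Lκ))³` the volume of the torus shell (law of total variance,
`variance_pi_decoratedTubeSum_le`, `variance_decoratedPairSum_le`). [folklore] -/
theorem variance_prod_decoratedTubeSum_le {σ : ℝ} (hsd : SmallDensity uniformProfile σ) {N : ℕ} (hN : 1 ≤ N)
    (k l : Fin 3) {L κ : ℝ} (hL : 0 < L) (hκ : 0 ≤ κ) (hεL : hsDiameter σ N * (1 + 2 * L * κ) < 1 / 2)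
    {h : T3 → ℝ} (hh : Measurable h) (hh1 : ∀ y, |h y| ≤ 1) (γ : Measure V3) [IsProbabilityMeasure γ]
    {ζ : ℝ} (hζ : 0 ≤ ζ)
    (hdec : ∀ i j i' j' : Fin (N + 1), i ≠ j → i ≠ i' → i ≠ j' → j ≠ i' → j ≠ j' → i' ≠ j' →
      ∀ T T' : Set T3, MeasurableSet T → MeasurableSet T' →
      |(∫ x, h (x i) * T.indicator (fun _ => (1 : ℝ)) (x j - x i) * (h (x i') * T'.indicator (fun _ => (1 : ℝ)) (x j' - x i'))
          ∂posGibbsMeasure (fun _ : T3 => (1 : ℝ)) (hsDiameter σ N) (N + 1)) -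
        (∫ x, h (x i) * T.indicator (fun _ => (1 : ℝ)) (x j - x i) ∂posGibbsMeasure (fun _ : T3 => (1 : ℝ)) (hsDiameter σ N) (N + 1)) *
        (∫ x, h (x i') * T'.indicator (fun _ => (1 : ℝ)) (x j' - x i') ∂posGibbsMeasure (fun _ : T3 => (1 : ℝ)) (hsDiameter σ N) (N + 1))|
        ≤ ζ * (volume T).toReal * (volume T').toReal) :
    variance (fun p : (Fin (N + 1) → T3) × (Fin (N + 1) → V3) =>
        ∑ i, ∑ j, if i ≠ j then h (p.1 i) * pairTubeMark (hsDiameter σ N) κ (evenMarkTrunc k l L) i j p.1 p.2 else 0)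
      ((posGibbsMeasure (fun _ : T3 => (1 : ℝ)) (hsDiameter σ N) (N + 1)).prod (Measure.pi fun _ : Fin (N + 1) => γ)) ≤
      64 * L ^ 2 * (3 + 4 * L * κ) ^ 6 * (N + 1 : ℕ) +
        2 * (((N + 1 : ℕ) : ℝ) ^ 2 * (16 * (2 * L) ^ 2 * (4 / 3 * Real.pi * (hsDiameter σ N * (1 + 2 * L * κ)) ^ 3) +
          96 * ((N + 1 : ℕ) : ℝ) * (2 * L) ^ 2 * (4 / 3 * Real.pi * (hsDiameter σ N * (1 + 2 * L * κ)) ^ 3) ^ 2 +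
          4 * ζ * ((N + 1 : ℕ) : ℝ) ^ 2 * (2 * L) ^ 2 * (4 / 3 * Real.pi * (hsDiameter σ N * (1 + 2 * L * κ)) ^ 3) ^ 2)) := by
  have hσ := hsd.σ_pos
  have hε := hsDiameter_pos hσ N
  haveI := isProbabilityMeasure_posGibbsMeasure continuous_const (fun _ => one_pos) hsd.σ_lt_half.le N
  set P := posGibbsMeasure (fun _ : T3 => (1 : ℝ)) (hsDiameter σ N) (N + 1) with hP
  set Q : Measure (Fin (N + 1) → V3) := Measure.pi fun _ : Fin (N + 1) => γ with hQ
  set ε := hsDiameter σ N with hεdef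
  set Ξ := evenMarkTrunc k l L with hΞ
  have hΞm : Measurable Ξ := (continuous_evenMarkTrunc k l L).measurable
  set S : (Fin (N + 1) → T3) × (Fin (N + 1) → V3) → ℝ := fun p =>
    ∑ i, ∑ j, if i ≠ j then h (p.1 i) * pairTubeMark ε κ Ξ i j p.1 p.2 else 0 with hS
  have hSm : Measurable S := measurable_decoratedTubeSum ε κ hΞm hh
  have hterm : ∀ (p : (Fin (N + 1) → T3) × (Fin (N + 1) → V3)) i j,
      |(if i ≠ j then h (p.1 i) * pairTubeMark ε κ Ξ i j p.1 p.2 else 0)| ≤ 2 * L := fun p i j => by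
    split_ifs
    · rw [abs_mul]
      exact (mul_le_mul (hh1 _) (abs_pairTubeMark_le _ κ (abs_evenMarkTrunc_le k l hL.le) i j p.1 p.2) (abs_nonneg _)
        zero_le_one).trans_eq (one_mul _)
    · rw [abs_zero]; linarith
  have hSb : ∀ p, |S p| ≤ (N + 1 : ℕ) * ((N + 1 : ℕ) * (2 * L)) := fun p => by
    refine (Finset.abs_sum_le_sum_abs _ _).trans ?_
    calc ∑ i, |∑ j, (if i ≠ j then h (p.1 i) * pairTubeMark ε κ Ξ i j p.1 p.2 else 0)|
        ≤ ∑ _i : Fin (N + 1), ((N + 1 : ℕ) * (2 * L)) := Finset.sum_le_sum fun i _ =>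
          (Finset.abs_sum_le_sum_abs _ _).trans ((Finset.sum_le_sum fun j _ => hterm p i j).trans (by
            rw [Finset.sum_const, Finset.card_univ, Fintype.card_fin, nsmul_eq_mul]))
      _ = (N + 1 : ℕ) * ((N + 1 : ℕ) * (2 * L)) := by
          rw [Finset.sum_const, Finset.card_univ, Fintype.card_fin, nsmul_eq_mul]
  -- law of total variance
  have hsplit := variance_prod_le P Q hSm hSb
  -- (i) the velocity variance at fixed positions, a.s. on the hard core
  have h1 : ∫ x, variance (fun v => S (x, v)) Q ∂P ≤ 32 * L ^ 2 * (3 + 4 * L * κ) ^ 6 * (N + 1 : ℕ) := by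
    have hae : ∀ᵐ x ∂P, variance (fun v => S (x, v)) Q ≤ 32 * L ^ 2 * (3 + 4 * L * κ) ^ 6 * (N + 1 : ℕ) := by
      filter_upwards [ae_mem_posDomain (fun _ : T3 => (1 : ℝ)) ε (N + 1)] with x hx
      exact variance_pi_decoratedTubeSum_le hσ k l hL.le hκ hh1 γ hx
    calc ∫ x, variance (fun v => S (x, v)) Q ∂P ≤ ∫ _x, 32 * L ^ 2 * (3 + 4 * L * κ) ^ 6 * (N + 1 : ℕ) ∂P :=
          integral_mono_of_nonneg (ae_of_all _ fun x => variance_nonneg _ _) (integrable_const _) hae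
      _ = 32 * L ^ 2 * (3 + 4 * L * κ) ^ 6 * (N + 1 : ℕ) := by rw [integral_const, probReal_univ, one_smul]
  -- (ii) the conditional mean is the decorated pair sum with the velocity-averaged tube mark
  set φ : T3 → ℝ := fun d => ∫ p, tubeMark κ Ξ (ε⁻¹ • Torus.reprSym (-d)) p.1 p.2 ∂(γ.prod γ) with hφ
  have hmean : (fun x => ∫ v, S (x, v) ∂Q) = fun x => ∑ i, ∑ j, if i ≠ j then h (x i) * φ (x j - x i) else 0 := by
    funext x
    exact integral_pi_decoratedTubeSum ε κ hΞm (abs_evenMarkTrunc_le k l hL.le) h γ x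
  set D : Set T3 := {d : T3 | ε < ‖Torus.reprSym d‖ ∧ ‖Torus.reprSym d‖ ≤ ε * (1 + 2 * L * κ)} with hD
  have hφm : Measurable φ := measurable_velAvg_tubeMark ε κ hΞm γ
  have hφB : ∀ d, |φ d| ≤ 2 * L := fun d => abs_velAvg_tubeMark_le k l hL.le ε κ γ d
  have hφD : ∀ d, φ d ≠ 0 → d ∈ D := fun d hd => mem_torusShell_of_velAvg_ne_zero k l hL.le hκ hε γ d hd
  have hDm : MeasurableSet D := measurableSet_torusShell ε _
  have hDs : ∀ d, d ∈ D ↔ -d ∈ D := fun d => mem_torusShell_iff_neg_mem ε _ d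
  have h2 := variance_decoratedPairSum_le hsd hN hh hh1 hφm (by linarith : 0 < 2 * L) hφB hDm hDs hφD hζ hdec
  -- the shell volume
  have hv : (volume D).toReal ≤ 4 / 3 * Real.pi * (ε * (1 + 2 * L * κ)) ^ 3 :=
    volume_real_torusShell_le ε (mul_nonneg hε.le (by nlinarith)) hεL
  have hv0 : 0 ≤ (volume D).toReal := ENNReal.toReal_nonneg
  have h2' : variance (fun x => ∫ v, S (x, v) ∂Q) P ≤
      ((N + 1 : ℕ) : ℝ) ^ 2 * (16 * (2 * L) ^ 2 * (4 / 3 * Real.pi * (ε * (1 + 2 * L * κ)) ^ 3) +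
        96 * ((N + 1 : ℕ) : ℝ) * (2 * L) ^ 2 * (4 / 3 * Real.pi * (ε * (1 + 2 * L * κ)) ^ 3) ^ 2 +
        4 * ζ * ((N + 1 : ℕ) : ℝ) ^ 2 * (2 * L) ^ 2 * (4 / 3 * Real.pi * (ε * (1 + 2 * L * κ)) ^ 3) ^ 2) := by
    rw [hmean]
    refine h2.trans ?_
    have hv2 : (volume D).toReal ^ 2 ≤ (4 / 3 * Real.pi * (ε * (1 + 2 * L * κ)) ^ 3) ^ 2 :=
      pow_le_pow_left₀ hv0 hv 2
    have hn : (0 : ℝ) ≤ ((N + 1 : ℕ) : ℝ) := by positivity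
    gcongr
  linarith [hsplit, h1, h2']


/-! ## The static variance bound -/

/-- `Var(X + Y) ≤ 2 Var X + 2 Var Y` in `L²` (parallelogram law of the covariance form). [folklore] -/
theorem variance_add_le_two_mul {Ω : Type*} [MeasurableSpace Ω] {μ : Measure Ω} [IsFiniteMeasure μ]
    {X Y : Ω → ℝ} (hX : MemLp X 2 μ) (hY : MemLp Y 2 μ) :
    variance (fun ω => X ω + Y ω) μ ≤ 2 * variance X μ + 2 * variance Y μ := by
  have h1 := variance_fun_add hX hY
  have h2 := variance_fun_sub hX hY
  have h0 := variance_nonneg (fun ω => X ω - Y ω) μ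
  linarith

end Literature.MathematicalPhysics.KineticTheory

end
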